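import Summits.ResolutionOfSingularities.ResolutionOfSingularities.Theorems.FrobeniusLadderFInjectiveMacaulayficationPointFixableTransport
import Summits.ResolutionOfSingularities.ResolutionOfSingularities.Theorems.FrobeniusLadderFInjectiveMacaulayficationT11PlusPrime
import Mathlib.AlgebraicGeometry.AffineScheme
import HarnessLib

/-!
# THE ORIGIN STALKS OF THE C.I. MODEL `T₁₁⁺` AND OF THE HYPERSURFACE `T₁₁` ARE ISOMORPHIC; `PFix` MOVES ACROSS (instance-ledger row I11, part 2)
# (crux `FrobeniusLadder.FInjectiveMacaulayfication` stmt-ResolutionOfSingularities-15315, chain w45a, road B; res-L1-w45a-plan-1 R12.19 (a);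
# seat res-L1-w45a-stub-2)

[OURS · L1 W4.5a] AI-written; AI review is weaker than expert review. NOT a statement of any manuscript; no named fact.

`T₁₁⁺ = Spec k[x,y,z,w,Φ]/(F₀, F₁)`, `F₀ = Φ − y² − x³`, `F₁ = z² + Φ³ + x¹¹ + w⁷` (`(x,y,z,w,Φ) = (X 0,…,X 4)`, conventions of
`T11PlusPrime` / `T11PlusOffStratum`), and `T₁₁ = Spec k[x,y,z,w]/(g)`, `g = z² + (y²+x³)³ + x¹¹ + w⁷` (`T11HypersurfacePrime`, `Fs 0 = g`).
Eliminating `Φ ↦ y² + x³` is a ring isomorphism of the coordinate rings (`exists_quotEquiv`, over `T11PlusPrime.span_pair_eq_comap`)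
matching the origin ideals (`quotEquiv_mem_origin_iff`), hence isomorphisms of the local rings at the origins (`Localization.AtPrime` and
the `Spec`-stalks, `Spec.stalkIso`). COROLLARY `t11Plus_h0_of_hypersurface`: `PFix(𝒪_{T₁₁,0}) → PFix(𝒪_{T₁₁⁺,0})` (any field `k`; the
maximality of the two origin ideals is taken as binders, supplied by `QuotientOriginMaximal`, pool U7) — the hypothesis `h0` of the specimen
door `T11SpecimenDoor.fInjectiveMacaulayfication_T11plus_char7` (stub-3, R12.24) from the road-B instance `PFix(𝒪_{T₁₁,0})` (I1–I8).
No definitions, no named facts. [folklore]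
-/

set_option linter.dupNamespace false

noncomputable section

open MvPolynomial AlgebraicGeometry

namespace Summit.ResolutionOfSingularities.ResolutionOfSingularities.Theorems.FInjectiveMacaulayfication.T11PlusOriginTransport

open Summit.ResolutionOfSingularities.ResolutionOfSingularities.Theorems.FInjectiveMacaulayfication

variable (k : Type) [Field k]

/-! ## The elimination map `φ : k[x,y,z,w,Φ] → k[x,y,z,w]`, `Φ ↦ y² + x³`, and the section `ι` -/

/-- Such a `φ` exists. [folklore] -/
theorem exists_phi : ∃ φ : MvPolynomial (Fin 5) k →ₐ[k] MvPolynomial (Fin 4) k,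
    (∀ i : Fin 4, φ (X i.castSucc) = X i) ∧ φ (X 4) = X 1 ^ 2 + X 0 ^ 3 :=
  ⟨MvPolynomial.aeval (Fin.snoc (fun i : Fin 4 => (X i : MvPolynomial (Fin 4) k)) (X 1 ^ 2 + X 0 ^ 3)),
    fun i => by rw [MvPolynomial.aeval_X, Fin.snoc_castSucc],
    by rw [MvPolynomial.aeval_X, show (4 : Fin 5) = Fin.last 4 from rfl, Fin.snoc_last]⟩

/-- `φ ∘ ι = id` for `ι = rename castSucc`. [folklore] -/
theorem phi_rename (φ : MvPolynomial (Fin 5) k →ₐ[k] MvPolynomial (Fin 4) k)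
    (hφ : ∀ i : Fin 4, φ (X i.castSucc) = X i) (q : MvPolynomial (Fin 4) k) : φ (MvPolynomial.rename Fin.castSucc q) = q := by
  have h : φ.comp (MvPolynomial.rename Fin.castSucc) = AlgHom.id k _ :=
    MvPolynomial.algHom_ext fun i => by rw [AlgHom.comp_apply, MvPolynomial.rename_X, hφ, AlgHom.id_apply]
  exact DFunLike.congr_fun h q

/-- `φ` is surjective. [folklore] -/
theorem phi_surjective (φ : MvPolynomial (Fin 5) k →ₐ[k] MvPolynomial (Fin 4) k)
    (hφ : ∀ i : Fin 4, φ (X i.castSucc) = X i) : Function.Surjective φ := fun q => ⟨_, phi_rename k φ hφ q⟩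

/-- `ι ∘ φ = ψ`, the substitution `Φ ↦ y² + x³` of `T11PlusPrime`. [folklore] -/
theorem rename_phi (φ : MvPolynomial (Fin 5) k →ₐ[k] MvPolynomial (Fin 4) k)
    (hφ : ∀ i : Fin 4, φ (X i.castSucc) = X i) (hφ4 : φ (X 4) = X 1 ^ 2 + X 0 ^ 3)
    (q : MvPolynomial (Fin 5) k) : MvPolynomial.rename Fin.castSucc (φ q) =
    MvPolynomial.aeval (R := k) (fun i : Fin 5 => if i = 4 then (X 1 ^ 2 + X 0 ^ 3 : MvPolynomial (Fin 5) k) else X i) q := by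
  have h : (MvPolynomial.rename (R := k) Fin.castSucc).comp φ =
      MvPolynomial.aeval (R := k) (fun i : Fin 5 => if i = 4 then (X 1 ^ 2 + X 0 ^ 3 : MvPolynomial (Fin 5) k) else X i) :=
    MvPolynomial.algHom_ext fun i => by
      rw [AlgHom.comp_apply, MvPolynomial.aeval_X]
      by_cases hi : i = 4
      · subst hi
        rw [hφ4, if_pos rfl]
        simp only [map_add, map_pow, MvPolynomial.rename_X]
        rfl
      · rw [if_neg hi]
        obtain ⟨j, rfl⟩ : ∃ j : Fin 4, Fin.castSucc j = i := by
          have : (i : ℕ) < 4 := by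
            have := i.isLt
            have hne : (i : ℕ) ≠ 4 := fun h => hi (Fin.ext h)
            omega
          exact ⟨⟨i, this⟩, Fin.ext rfl⟩
        rw [hφ, MvPolynomial.rename_X]
  exact DFunLike.congr_fun h q

/-- `φ ∘ ψ = φ`. [folklore] -/
theorem phi_substKey (φ : MvPolynomial (Fin 5) k →ₐ[k] MvPolynomial (Fin 4) k)
    (hφ : ∀ i : Fin 4, φ (X i.castSucc) = X i) (hφ4 : φ (X 4) = X 1 ^ 2 + X 0 ^ 3) (q : MvPolynomial (Fin 5) k) :
    φ (MvPolynomial.aeval (R := k) (fun i : Fin 5 => if i = 4 then (X 1 ^ 2 + X 0 ^ 3 : MvPolynomial (Fin 5) k) else X i) q) = φ q := by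
  rw [← rename_phi k φ hφ hφ4 q, phi_rename k φ hφ]

/-- `φ (g₅) = g₄` for the hypersurface equation written in five resp. four variables. [folklore] -/
theorem phi_g (φ : MvPolynomial (Fin 5) k →ₐ[k] MvPolynomial (Fin 4) k)
    (hφ : ∀ i : Fin 4, φ (X i.castSucc) = X i) : φ (X 2 ^ 2 + (X 1 ^ 2 + X 0 ^ 3) ^ 3 + X 0 ^ 11 + X 3 ^ 7) =
    (X 2 ^ 2 + (X 1 ^ 2 + X 0 ^ 3) ^ 3 + X 0 ^ 11 + X 3 ^ 7 : MvPolynomial (Fin 4) k) := by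
  have h0 := hφ 0; have h1 := hφ 1; have h2 := hφ 2; have h3 := hφ 3
  simp only [Fin.castSucc_zero, Fin.castSucc_one] at h0 h1
  rw [show (Fin.castSucc (2 : Fin 4) : Fin 5) = 2 from rfl] at h2
  rw [show (Fin.castSucc (3 : Fin 4) : Fin 5) = 3 from rfl] at h3
  simp only [map_add, map_pow, h0, h1, h2, h3]

/-- `ι (g₄) = g₅`. [folklore] -/
theorem rename_g : MvPolynomial.rename (R := k) Fin.castSucc (X 2 ^ 2 + (X 1 ^ 2 + X 0 ^ 3) ^ 3 + X 0 ^ 11 + X 3 ^ 7 : MvPolynomial (Fin 4) k) =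
    (X 2 ^ 2 + (X 1 ^ 2 + X 0 ^ 3) ^ 3 + X 0 ^ 11 + X 3 ^ 7 : MvPolynomial (Fin 5) k) := by
  simp only [map_add, map_pow, MvPolynomial.rename_X]
  rfl

/-- **The kernel of `k[x,y,z,w,Φ] → k[x,y,z,w]/(g)` is `(F₀, F₁)`.** [folklore] -/
theorem mem_span_pair_iff (φ : MvPolynomial (Fin 5) k →ₐ[k] MvPolynomial (Fin 4) k)
    (hφ : ∀ i : Fin 4, φ (X i.castSucc) = X i) (hφ4 : φ (X 4) = X 1 ^ 2 + X 0 ^ 3) (F₀ F₁ : MvPolynomial (Fin 5) k)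
    (hF₀ : F₀ = X 4 - X 1 ^ 2 - X 0 ^ 3) (hF₁ : F₁ = X 2 ^ 2 + X 4 ^ 3 + X 0 ^ 11 + X 3 ^ 7) (q : MvPolynomial (Fin 5) k) :
    q ∈ Ideal.span ({F₀, F₁} : Set (MvPolynomial (Fin 5) k)) ↔
      φ q ∈ Ideal.span ({X 2 ^ 2 + (X 1 ^ 2 + X 0 ^ 3) ^ 3 + X 0 ^ 11 + X 3 ^ 7} : Set (MvPolynomial (Fin 4) k)) := by
  rw [T11PlusPrime.span_pair_eq_comap k F₀ F₁ _ hF₀ hF₁ rfl, Ideal.mem_comap]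
  change MvPolynomial.aeval (R := k) (fun i : Fin 5 => if i = 4 then (X 1 ^ 2 + X 0 ^ 3 : MvPolynomial (Fin 5) k) else X i) q ∈ _ ↔ _
  constructor
  · intro h
    obtain ⟨r, hr⟩ := Ideal.mem_span_singleton'.mp h
    rw [← phi_substKey k φ hφ hφ4 q, ← hr, map_mul, phi_g k φ hφ]
    exact Ideal.mem_span_singleton'.mpr ⟨_, rfl⟩
  · intro h
    obtain ⟨r, hr⟩ := Ideal.mem_span_singleton'.mp h
    rw [← rename_phi k φ hφ hφ4 q, ← hr, map_mul, rename_g k]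
    exact Ideal.mem_span_singleton'.mpr ⟨_, rfl⟩

/-- `Set.range` of a pair. [folklore] -/
theorem range_fin_two {α : Type} (F : Fin 2 → α) : Set.range F = {F 0, F 1} := by
  ext x
  simp only [Set.mem_range, Set.mem_insert_iff, Set.mem_singleton_iff]
  constructor
  · rintro ⟨i, rfl⟩
    fin_cases i
    · exact Or.inl rfl
    · exact Or.inr rfl
  · rintro (rfl | rfl)
    · exact ⟨0, rfl⟩
    · exact ⟨1, rfl⟩

/-- `Set.range` of a singleton family. [folklore] -/
theorem range_fin_one {α : Type} (G : Fin 1 → α) : Set.range G = {G 0} := by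
  ext x
  simp only [Set.mem_range, Set.mem_singleton_iff]
  constructor
  · rintro ⟨i, rfl⟩
    fin_cases i
    rfl
  · rintro rfl
    exact ⟨0, rfl⟩

/-- **THE COORDINATE RINGS OF `T₁₁⁺` AND `T₁₁` ARE ISOMORPHIC** by `Φ ↦ y² + x³` (any field). [folklore] -/
theorem exists_quotEquiv (Fs : Fin 2 → MvPolynomial (Fin 5) k)
    (hF₀ : Fs 0 = X 4 - X 1 ^ 2 - X 0 ^ 3) (hF₁ : Fs 1 = X 2 ^ 2 + X 4 ^ 3 + X 0 ^ 11 + X 3 ^ 7)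
    (Gs : Fin 1 → MvPolynomial (Fin 4) k) (hG : Gs 0 = X 2 ^ 2 + (X 1 ^ 2 + X 0 ^ 3) ^ 3 + X 0 ^ 11 + X 3 ^ 7)
    (φ : MvPolynomial (Fin 5) k →ₐ[k] MvPolynomial (Fin 4) k)
    (hφ : ∀ i : Fin 4, φ (X i.castSucc) = X i) (hφ4 : φ (X 4) = X 1 ^ 2 + X 0 ^ 3) :
    ∃ e : (MvPolynomial (Fin 5) k ⧸ Ideal.span (Set.range Fs)) ≃+* (MvPolynomial (Fin 4) k ⧸ Ideal.span (Set.range Gs)),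
      ∀ q : MvPolynomial (Fin 5) k, e (Ideal.Quotient.mk (Ideal.span (Set.range Fs)) q) =
        Ideal.Quotient.mk (Ideal.span (Set.range Gs)) (φ q) := by
  set f : MvPolynomial (Fin 5) k →ₐ[k] (MvPolynomial (Fin 4) k ⧸ Ideal.span (Set.range Gs)) :=
    (Ideal.Quotient.mkₐ k (Ideal.span (Set.range Gs))).comp φ with hf
  have hfq : ∀ q, f q = Ideal.Quotient.mk (Ideal.span (Set.range Gs)) (φ q) := fun q => rfl
  have hsurj : Function.Surjective f :=
    (Ideal.Quotient.mkₐ_surjective k _).comp (phi_surjective k φ hφ)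
  have hGs : Ideal.span (Set.range Gs) = Ideal.span {(X 2 ^ 2 + (X 1 ^ 2 + X 0 ^ 3) ^ 3 + X 0 ^ 11 + X 3 ^ 7 : MvPolynomial (Fin 4) k)} := by
    rw [range_fin_one, hG]
  have hker : Ideal.span (Set.range Fs) = RingHom.ker f.toRingHom := by
    ext q
    rw [RingHom.mem_ker, AlgHom.toRingHom_eq_coe, AlgHom.coe_toRingHom, hfq, Ideal.Quotient.eq_zero_iff_mem, hGs, range_fin_two,
      ← mem_span_pair_iff k φ hφ hφ4 (Fs 0) (Fs 1) hF₀ hF₁ q]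
  refine ⟨(Ideal.quotEquivOfEq hker).trans (Ideal.quotientKerAlgEquivOfSurjective hsurj).toRingEquiv, fun q => ?_⟩
  rw [RingEquiv.trans_apply, Ideal.quotEquivOfEq_mk]
  exact (Ideal.quotientKerAlgEquivOfSurjective_apply hsurj _).trans (Ideal.kerLiftAlg_mk f q)

/-- The isomorphism matches the ORIGIN ideals. [folklore] -/
theorem quotEquiv_mem_origin_iff (Fs : Fin 2 → MvPolynomial (Fin 5) k) (Gs : Fin 1 → MvPolynomial (Fin 4) k)
    (φ : MvPolynomial (Fin 5) k →ₐ[k] MvPolynomial (Fin 4) k)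
    (hφ : ∀ i : Fin 4, φ (X i.castSucc) = X i) (hφ4 : φ (X 4) = X 1 ^ 2 + X 0 ^ 3)
    (e : (MvPolynomial (Fin 5) k ⧸ Ideal.span (Set.range Fs)) ≃+* (MvPolynomial (Fin 4) k ⧸ Ideal.span (Set.range Gs)))
    (he : ∀ q : MvPolynomial (Fin 5) k, e (Ideal.Quotient.mk (Ideal.span (Set.range Fs)) q) =
        Ideal.Quotient.mk (Ideal.span (Set.range Gs)) (φ q)) (x : MvPolynomial (Fin 5) k ⧸ Ideal.span (Set.range Fs)) :
    e x ∈ Ideal.span (Set.range fun i : Fin 4 => Ideal.Quotient.mk (Ideal.span (Set.range Gs)) (MvPolynomial.X i)) ↔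
      x ∈ Ideal.span (Set.range fun i : Fin 5 => Ideal.Quotient.mk (Ideal.span (Set.range Fs)) (MvPolynomial.X i)) := by
  -- the image of the origin ideal of `T₁₁⁺` is the origin ideal of `T₁₁`
  have hmap : Ideal.map e (Ideal.span (Set.range fun i : Fin 5 => Ideal.Quotient.mk (Ideal.span (Set.range Fs)) (MvPolynomial.X i))) =
      Ideal.span (Set.range fun i : Fin 4 => Ideal.Quotient.mk (Ideal.span (Set.range Gs)) (MvPolynomial.X i)) := by
    apply le_antisymm
    · rw [Ideal.map_span, Ideal.span_le]
      rintro _ ⟨_, ⟨i, rfl⟩, rfl⟩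
      show e (Ideal.Quotient.mk (Ideal.span (Set.range Fs)) (MvPolynomial.X i)) ∈ _
      rw [he]
      by_cases hi : i = 4
      · subst hi
        rw [hφ4, map_add, map_pow, map_pow]
        have h1 : Ideal.Quotient.mk (Ideal.span (Set.range Gs)) (MvPolynomial.X 1) ∈
            Ideal.span (Set.range fun i : Fin 4 => Ideal.Quotient.mk (Ideal.span (Set.range Gs)) (MvPolynomial.X i)) :=
          Ideal.subset_span ⟨1, rfl⟩
        have h0 : Ideal.Quotient.mk (Ideal.span (Set.range Gs)) (MvPolynomial.X 0) ∈
            Ideal.span (Set.range fun i : Fin 4 => Ideal.Quotient.mk (Ideal.span (Set.range Gs)) (MvPolynomial.X i)) :=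
          Ideal.subset_span ⟨0, rfl⟩
        exact Ideal.add_mem _ (Ideal.pow_mem_of_mem _ h1 2 two_pos) (Ideal.pow_mem_of_mem _ h0 3 (by norm_num))
      · obtain ⟨j, rfl⟩ : ∃ j : Fin 4, Fin.castSucc j = i := by
          have hne : (i : ℕ) ≠ 4 := fun h => hi (Fin.ext h)
          have := i.isLt
          exact ⟨⟨i, by omega⟩, Fin.ext rfl⟩
        rw [hφ]
        exact Ideal.subset_span ⟨j, rfl⟩
    · rw [Ideal.span_le]
      rintro _ ⟨j, rfl⟩
      show Ideal.Quotient.mk (Ideal.span (Set.range Gs)) (MvPolynomial.X j) ∈ _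
      rw [show Ideal.Quotient.mk (Ideal.span (Set.range Gs)) (MvPolynomial.X j) =
        e (Ideal.Quotient.mk (Ideal.span (Set.range Fs)) (MvPolynomial.X j.castSucc)) from by rw [he, hφ]]
      exact Ideal.mem_map_of_mem _ (Ideal.subset_span ⟨j.castSucc, rfl⟩)
  constructor
  · intro h
    rw [← hmap, ← Ideal.comap_symm, Ideal.mem_comap] at h
    simpa using h
  · intro h
    rw [← hmap]
    exact Ideal.mem_map_of_mem _ h

/-- **THE LOCAL RINGS OF `T₁₁⁺` AND `T₁₁` AT THE ORIGINS ARE ISOMORPHIC** (`Localization.AtPrime` form). [folklore] -/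
theorem nonempty_originLocalization_ringEquiv (Fs : Fin 2 → MvPolynomial (Fin 5) k)
    (hF₀ : Fs 0 = X 4 - X 1 ^ 2 - X 0 ^ 3) (hF₁ : Fs 1 = X 2 ^ 2 + X 4 ^ 3 + X 0 ^ 11 + X 3 ^ 7)
    (Gs : Fin 1 → MvPolynomial (Fin 4) k) (hG : Gs 0 = X 2 ^ 2 + (X 1 ^ 2 + X 0 ^ 3) ^ 3 + X 0 ^ 11 + X 3 ^ 7)
    [hCI : (Ideal.span (Set.range fun i : Fin 5 => Ideal.Quotient.mk (Ideal.span (Set.range Fs)) (MvPolynomial.X i))).IsPrime]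
    [hH : (Ideal.span (Set.range fun i : Fin 4 => Ideal.Quotient.mk (Ideal.span (Set.range Gs)) (MvPolynomial.X i))).IsPrime] :
    Nonempty (Localization.AtPrime (Ideal.span (Set.range fun i : Fin 5 => Ideal.Quotient.mk (Ideal.span (Set.range Fs)) (MvPolynomial.X i))) ≃+*
      Localization.AtPrime (Ideal.span (Set.range fun i : Fin 4 => Ideal.Quotient.mk (Ideal.span (Set.range Gs)) (MvPolynomial.X i)))) := by
  obtain ⟨φ, hφ, hφ4⟩ := exists_phi k
  obtain ⟨e, he⟩ := exists_quotEquiv k Fs hF₀ hF₁ Gs hG φ hφ hφ4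
  exact BlowupFiModelOfCover.nonempty_ringEquiv_localization_of_ringEquiv e _ _
    (fun x => quotEquiv_mem_origin_iff k Fs Gs φ hφ hφ4 e he x)

/-- **THE STALKS OF `Spec` AT THE ORIGINS ARE ISOMORPHIC** (scheme form, via `Spec.stalkIso`). [folklore] -/
theorem nonempty_originStalk_ringEquiv (Fs : Fin 2 → MvPolynomial (Fin 5) k)
    (hF₀ : Fs 0 = X 4 - X 1 ^ 2 - X 0 ^ 3) (hF₁ : Fs 1 = X 2 ^ 2 + X 4 ^ 3 + X 0 ^ 11 + X 3 ^ 7)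
    (Gs : Fin 1 → MvPolynomial (Fin 4) k) (hG : Gs 0 = X 2 ^ 2 + (X 1 ^ 2 + X 0 ^ 3) ^ 3 + X 0 ^ 11 + X 3 ^ 7)
    (h𝔪CI : (Ideal.span (Set.range fun i : Fin 5 => Ideal.Quotient.mk (Ideal.span (Set.range Fs)) (MvPolynomial.X i))).IsMaximal)
    (h𝔪H : (Ideal.span (Set.range fun i : Fin 4 => Ideal.Quotient.mk (Ideal.span (Set.range Gs)) (MvPolynomial.X i))).IsMaximal) :
    Nonempty ((Spec (.of (MvPolynomial (Fin 5) k ⧸ Ideal.span (Set.range Fs)))).presheaf.stalk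
        (⟨Ideal.span (Set.range fun i : Fin 5 => Ideal.Quotient.mk (Ideal.span (Set.range Fs)) (MvPolynomial.X i)), h𝔪CI.isPrime⟩ :
          PrimeSpectrum (MvPolynomial (Fin 5) k ⧸ Ideal.span (Set.range Fs))) ≃+*
      (Spec (.of (MvPolynomial (Fin 4) k ⧸ Ideal.span (Set.range Gs)))).presheaf.stalk
        (⟨Ideal.span (Set.range fun i : Fin 4 => Ideal.Quotient.mk (Ideal.span (Set.range Gs)) (MvPolynomial.X i)), h𝔪H.isPrime⟩ :
          PrimeSpectrum (MvPolynomial (Fin 4) k ⧸ Ideal.span (Set.range Gs)))) := by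
  haveI := h𝔪CI.isPrime
  haveI := h𝔪H.isPrime
  obtain ⟨eL⟩ := nonempty_originLocalization_ringEquiv k Fs hF₀ hF₁ Gs hG
  exact ⟨((Spec.stalkIso (.of (MvPolynomial (Fin 5) k ⧸ Ideal.span (Set.range Fs)))
      ⟨Ideal.span (Set.range fun i : Fin 5 => Ideal.Quotient.mk (Ideal.span (Set.range Fs)) (MvPolynomial.X i)), h𝔪CI.isPrime⟩).commRingCatIsoToRingEquiv.trans
      eL).trans
    (Spec.stalkIso (.of (MvPolynomial (Fin 4) k ⧸ Ideal.span (Set.range Gs)))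
      ⟨Ideal.span (Set.range fun i : Fin 4 => Ideal.Quotient.mk (Ideal.span (Set.range Gs)) (MvPolynomial.X i)), h𝔪H.isPrime⟩).commRingCatIsoToRingEquiv.symm⟩

/-- **`h0` OF THE SPECIMEN DOOR FROM THE ROAD-B INSTANCE**: `PFix(𝒪_{T₁₁, 0}) → PFix(𝒪_{T₁₁⁺, 0})` (any field `k`, any `p`; `PFix` text
VERBATIM as in `PointFixableOfCert.pointFixable_of_ciCert`). [folklore] -/
theorem t11Plus_h0_of_hypersurface (p : ℕ) (Fs : Fin 2 → MvPolynomial (Fin 5) k)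
    (hF₀ : Fs 0 = X 4 - X 1 ^ 2 - X 0 ^ 3) (hF₁ : Fs 1 = X 2 ^ 2 + X 4 ^ 3 + X 0 ^ 11 + X 3 ^ 7)
    (Gs : Fin 1 → MvPolynomial (Fin 4) k) (hG : Gs 0 = X 2 ^ 2 + (X 1 ^ 2 + X 0 ^ 3) ^ 3 + X 0 ^ 11 + X 3 ^ 7)
    (h𝔪H : (Ideal.span (Set.range fun i : Fin 4 => Ideal.Quotient.mk (Ideal.span (Set.range Gs)) (MvPolynomial.X i))).IsMaximal)
    (h𝔪CI : (Ideal.span (Set.range fun i : Fin 5 => Ideal.Quotient.mk (Ideal.span (Set.range Fs)) (MvPolynomial.X i))).IsMaximal)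
    (h0 : ∃ (nc : ℕ) (c : Fin nc → (Spec (.of (MvPolynomial (Fin 4) k ⧸ Ideal.span (Set.range Gs)))).presheaf.stalk (⟨Ideal.span (Set.range fun i : Fin 4 => Ideal.Quotient.mk (Ideal.span (Set.range Gs)) (MvPolynomial.X i)), h𝔪H.isPrime⟩ : PrimeSpectrum (MvPolynomial (Fin 4) k ⧸ Ideal.span (Set.range Gs)))), Ideal.span (Set.range c) ≠ ⊥ ∧ (Ideal.span (Set.range c)).radical = IsLocalRing.maximalIdeal ((Spec (.of (MvPolynomial (Fin 4) k ⧸ Ideal.span (Set.range Gs)))).presheaf.stalk (⟨Ideal.span (Set.range fun i : Fin 4 => Ideal.Quotient.mk (Ideal.span (Set.range Gs)) (MvPolynomial.X i)), h𝔪H.isPrime⟩ : PrimeSpectrum (MvPolynomial (Fin 4) k ⧸ Ideal.span (Set.range Gs)))) ∧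
        ∀ (j : Fin nc) (𝔔 : PrimeSpectrum (Literature.AlgebraicGeometry.Resolution.blowupAlgebra (Ideal.span (Set.range c)) (c j))),
          𝔔.asIdeal.comap (algebraMap ((Spec (.of (MvPolynomial (Fin 4) k ⧸ Ideal.span (Set.range Gs)))).presheaf.stalk (⟨Ideal.span (Set.range fun i : Fin 4 => Ideal.Quotient.mk (Ideal.span (Set.range Gs)) (MvPolynomial.X i)), h𝔪H.isPrime⟩ : PrimeSpectrum (MvPolynomial (Fin 4) k ⧸ Ideal.span (Set.range Gs)))) (Literature.AlgebraicGeometry.Resolution.blowupAlgebra (Ideal.span (Set.range c)) (c j))) = IsLocalRing.maximalIdeal ((Spec (.of (MvPolynomial (Fin 4) k ⧸ Ideal.span (Set.range Gs)))).presheaf.stalk (⟨Ideal.span (Set.range fun i : Fin 4 => Ideal.Quotient.mk (Ideal.span (Set.range Gs)) (MvPolynomial.X i)), h𝔪H.isPrime⟩ : PrimeSpectrum (MvPolynomial (Fin 4) k ⧸ Ideal.span (Set.range Gs)))) →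
          IsDomain (Localization.AtPrime 𝔔.asIdeal) ∧ ∀ d : ℕ, ringKrullDim (Localization.AtPrime 𝔔.asIdeal) = d → ∀ s : Fin d → Localization.AtPrime 𝔔.asIdeal, (Ideal.span (Set.range s)).radical.IsMaximal → RingTheory.Sequence.IsWeaklyRegular (Localization.AtPrime 𝔔.asIdeal) (List.ofFn s) ∧ ∀ y : Localization.AtPrime 𝔔.asIdeal, (∃ e : ℕ, y ^ p ^ e ∈ Ideal.span ((fun z : Localization.AtPrime 𝔔.asIdeal => z ^ p ^ e) '' (Ideal.span (Set.range s) : Set (Localization.AtPrime 𝔔.asIdeal)))) → y ∈ Ideal.span (Set.range s)) :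
    (∃ (nc : ℕ) (c : Fin nc → (Spec (.of (MvPolynomial (Fin 5) k ⧸ Ideal.span (Set.range Fs)))).presheaf.stalk (⟨Ideal.span (Set.range fun i : Fin 5 => Ideal.Quotient.mk (Ideal.span (Set.range Fs)) (MvPolynomial.X i)), h𝔪CI.isPrime⟩ : PrimeSpectrum (MvPolynomial (Fin 5) k ⧸ Ideal.span (Set.range Fs)))), Ideal.span (Set.range c) ≠ ⊥ ∧ (Ideal.span (Set.range c)).radical = IsLocalRing.maximalIdeal ((Spec (.of (MvPolynomial (Fin 5) k ⧸ Ideal.span (Set.range Fs)))).presheaf.stalk (⟨Ideal.span (Set.range fun i : Fin 5 => Ideal.Quotient.mk (Ideal.span (Set.range Fs)) (MvPolynomial.X i)), h𝔪CI.isPrime⟩ : PrimeSpectrum (MvPolynomial (Fin 5) k ⧸ Ideal.span (Set.range Fs)))) ∧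
        ∀ (j : Fin nc) (𝔔 : PrimeSpectrum (Literature.AlgebraicGeometry.Resolution.blowupAlgebra (Ideal.span (Set.range c)) (c j))),
          𝔔.asIdeal.comap (algebraMap ((Spec (.of (MvPolynomial (Fin 5) k ⧸ Ideal.span (Set.range Fs)))).presheaf.stalk (⟨Ideal.span (Set.range fun i : Fin 5 => Ideal.Quotient.mk (Ideal.span (Set.range Fs)) (MvPolynomial.X i)), h𝔪CI.isPrime⟩ : PrimeSpectrum (MvPolynomial (Fin 5) k ⧸ Ideal.span (Set.range Fs)))) (Literature.AlgebraicGeometry.Resolution.blowupAlgebra (Ideal.span (Set.range c)) (c j))) = IsLocalRing.maximalIdeal ((Spec (.of (MvPolynomial (Fin 5) k ⧸ Ideal.span (Set.range Fs)))).presheaf.stalk (⟨Ideal.span (Set.range fun i : Fin 5 => Ideal.Quotient.mk (Ideal.span (Set.range Fs)) (MvPolynomial.X i)), h𝔪CI.isPrime⟩ : PrimeSpectrum (MvPolynomial (Fin 5) k ⧸ Ideal.span (Set.range Fs)))) →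
          IsDomain (Localization.AtPrime 𝔔.asIdeal) ∧ ∀ d : ℕ, ringKrullDim (Localization.AtPrime 𝔔.asIdeal) = d → ∀ s : Fin d → Localization.AtPrime 𝔔.asIdeal, (Ideal.span (Set.range s)).radical.IsMaximal → RingTheory.Sequence.IsWeaklyRegular (Localization.AtPrime 𝔔.asIdeal) (List.ofFn s) ∧ ∀ y : Localization.AtPrime 𝔔.asIdeal, (∃ e : ℕ, y ^ p ^ e ∈ Ideal.span ((fun z : Localization.AtPrime 𝔔.asIdeal => z ^ p ^ e) '' (Ideal.span (Set.range s) : Set (Localization.AtPrime 𝔔.asIdeal)))) → y ∈ Ideal.span (Set.range s)) := by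
  exact (nonempty_originStalk_ringEquiv k Fs hF₀ hF₁ Gs hG h𝔪CI h𝔪H).elim fun E =>
    PointFixableTransport.pointFixable_of_ringEquiv p E.symm h0

/-- **THE DOOR'S `h0` FROM THE FRAME'S LOCALISATION FORM** (R12.29 (d)): from `PFix(Localization.AtPrime 𝔪_{T₁₁,0})` — the output of the
road-B frame `t11_originPointFixable_char7` — to the hypothesis `h0` of `T11SpecimenDoor.fInjectiveMacaulayfication_T11plus_char7` VERBATIM
(`∀ b`, `b.asIdeal =` the origin ideal of `T₁₁⁺` `→ PFix(𝒪_{Spec, b})`), any field, any `p` (the door instantiates `p := 7`). [folklore] -/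
theorem t11Plus_h0_of_localization (p : ℕ) (Fs : Fin 2 → MvPolynomial (Fin 5) k)
    (hF₀ : Fs 0 = X 4 - X 1 ^ 2 - X 0 ^ 3) (hF₁ : Fs 1 = X 2 ^ 2 + X 4 ^ 3 + X 0 ^ 11 + X 3 ^ 7)
    (Gs : Fin 1 → MvPolynomial (Fin 4) k) (hG : Gs 0 = X 2 ^ 2 + (X 1 ^ 2 + X 0 ^ 3) ^ 3 + X 0 ^ 11 + X 3 ^ 7)
    [hH : (Ideal.span (Set.range fun i : Fin 4 => Ideal.Quotient.mk (Ideal.span (Set.range Gs)) (MvPolynomial.X i))).IsPrime]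
    (hPF : ∃ (nc : ℕ) (c : Fin nc → Localization.AtPrime (Ideal.span (Set.range fun i : Fin 4 => Ideal.Quotient.mk (Ideal.span (Set.range Gs)) (MvPolynomial.X i)))), Ideal.span (Set.range c) ≠ ⊥ ∧ (Ideal.span (Set.range c)).radical = IsLocalRing.maximalIdeal (Localization.AtPrime (Ideal.span (Set.range fun i : Fin 4 => Ideal.Quotient.mk (Ideal.span (Set.range Gs)) (MvPolynomial.X i)))) ∧
        ∀ (j : Fin nc) (𝔔 : PrimeSpectrum (Literature.AlgebraicGeometry.Resolution.blowupAlgebra (Ideal.span (Set.range c)) (c j))),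
          𝔔.asIdeal.comap (algebraMap (Localization.AtPrime (Ideal.span (Set.range fun i : Fin 4 => Ideal.Quotient.mk (Ideal.span (Set.range Gs)) (MvPolynomial.X i)))) (Literature.AlgebraicGeometry.Resolution.blowupAlgebra (Ideal.span (Set.range c)) (c j))) = IsLocalRing.maximalIdeal (Localization.AtPrime (Ideal.span (Set.range fun i : Fin 4 => Ideal.Quotient.mk (Ideal.span (Set.range Gs)) (MvPolynomial.X i)))) →
          IsDomain (Localization.AtPrime 𝔔.asIdeal) ∧ ∀ d : ℕ, ringKrullDim (Localization.AtPrime 𝔔.asIdeal) = d → ∀ s : Fin d → Localization.AtPrime 𝔔.asIdeal, (Ideal.span (Set.range s)).radical.IsMaximal → RingTheory.Sequence.IsWeaklyRegular (Localization.AtPrime 𝔔.asIdeal) (List.ofFn s) ∧ ∀ y : Localization.AtPrime 𝔔.asIdeal, (∃ e : ℕ, y ^ p ^ e ∈ Ideal.span ((fun z : Localization.AtPrime 𝔔.asIdeal => z ^ p ^ e) '' (Ideal.span (Set.range s) : Set (Localization.AtPrime 𝔔.asIdeal)))) → y ∈ Ideal.span (Set.range s)) :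
    ∀ b : ↥(Spec (.of (MvPolynomial (Fin 5) k ⧸ Ideal.span (Set.range Fs)))),
      b.asIdeal = Ideal.span (Set.range fun j : Fin 5 => Ideal.Quotient.mk (Ideal.span (Set.range Fs)) (MvPolynomial.X j)) →
    (∃ (nc : ℕ) (c : Fin nc → (Spec (.of (MvPolynomial (Fin 5) k ⧸ Ideal.span (Set.range Fs)))).presheaf.stalk b), Ideal.span (Set.range c) ≠ ⊥ ∧ (Ideal.span (Set.range c)).radical = IsLocalRing.maximalIdeal ((Spec (.of (MvPolynomial (Fin 5) k ⧸ Ideal.span (Set.range Fs)))).presheaf.stalk b) ∧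
        ∀ (j : Fin nc) (𝔔 : PrimeSpectrum (Literature.AlgebraicGeometry.Resolution.blowupAlgebra (Ideal.span (Set.range c)) (c j))),
          𝔔.asIdeal.comap (algebraMap ((Spec (.of (MvPolynomial (Fin 5) k ⧸ Ideal.span (Set.range Fs)))).presheaf.stalk b) (Literature.AlgebraicGeometry.Resolution.blowupAlgebra (Ideal.span (Set.range c)) (c j))) = IsLocalRing.maximalIdeal ((Spec (.of (MvPolynomial (Fin 5) k ⧸ Ideal.span (Set.range Fs)))).presheaf.stalk b) →
          IsDomain (Localization.AtPrime 𝔔.asIdeal) ∧ ∀ d : ℕ, ringKrullDim (Localization.AtPrime 𝔔.asIdeal) = d → ∀ s : Fin d → Localization.AtPrime 𝔔.asIdeal, (Ideal.span (Set.range s)).radical.IsMaximal → RingTheory.Sequence.IsWeaklyRegular (Localization.AtPrime 𝔔.asIdeal) (List.ofFn s) ∧ ∀ y : Localization.AtPrime 𝔔.asIdeal, (∃ e : ℕ, y ^ p ^ e ∈ Ideal.span ((fun z : Localization.AtPrime 𝔔.asIdeal => z ^ p ^ e) '' (Ideal.span (Set.range s) : Set (Localization.AtPrime 𝔔.asIdeal))))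 → y ∈ Ideal.span (Set.range s)) := by
  intro b hb
  haveI hCI : (Ideal.span (Set.range fun j : Fin 5 => Ideal.Quotient.mk (Ideal.span (Set.range Fs)) (MvPolynomial.X j))).IsPrime :=
    hb ▸ b.isPrime
  haveI := b.isPrime
  -- `(T₁₁⁺)_𝔪 ≅ (T₁₁⁺)_b` along the identity (`b.asIdeal = 𝔪`), then the stalk
  have e_b := BlowupFiModelOfCover.nonempty_ringEquiv_localization_of_ringEquiv
    (RingEquiv.refl (MvPolynomial (Fin 5) k ⧸ Ideal.span (Set.range Fs)))
    (Ideal.span (Set.range fun j : Fin 5 => Ideal.Quotient.mk (Ideal.span (Set.range Fs)) (MvPolynomial.X j))) b.asIdeal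
    (fun x => by rw [hb]; exact Iff.rfl)
  refine (nonempty_originLocalization_ringEquiv k Fs hF₀ hF₁ Gs hG).elim fun eL => e_b.elim fun eb => ?_
  have h1 := PointFixableTransport.pointFixable_of_ringEquiv p
    (O := Localization.AtPrime (Ideal.span (Set.range fun i : Fin 4 => Ideal.Quotient.mk (Ideal.span (Set.range Gs)) (MvPolynomial.X i))))
    (O' := Localization.AtPrime (Ideal.span (Set.range fun j : Fin 5 => Ideal.Quotient.mk (Ideal.span (Set.range Fs)) (MvPolynomial.X j))))
    eL.symm hPF
  have h2 := PointFixableTransport.pointFixable_of_ringEquiv p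
    (O := Localization.AtPrime (Ideal.span (Set.range fun j : Fin 5 => Ideal.Quotient.mk (Ideal.span (Set.range Fs)) (MvPolynomial.X j))))
    (O' := Localization.AtPrime b.asIdeal) eb h1
  exact PointFixableTransport.pointFixable_of_ringEquiv p (O := Localization.AtPrime b.asIdeal)
    (O' := ↥((Spec (.of (MvPolynomial (Fin 5) k ⧸ Ideal.span (Set.range Fs)))).presheaf.stalk b))
    (Spec.stalkIso (.of (MvPolynomial (Fin 5) k ⧸ Ideal.span (Set.range Fs))) b).commRingCatIsoToRingEquiv.symm h2

end Summit.ResolutionOfSingularities.ResolutionOfSingularities.Theorems.FInjectiveMacaulayfication.T11PlusOriginTransport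

end
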